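import Summits.QuantumFields.YangMills.Theorems.BalabanUVNodesN09B12LetterCurlIsPinnedFieldStrength
import Summits.QuantumFields.YangMills.Theorems.BalabanUVNodesN09B12FailingLemmaUnderOrbitTie

/-!
# NODE N09 ([Balaban1987RG1] Lemma 4 (3.53) p. 280), FLAG №7 LOCATED RIDER 4, PART B — THE LETTER LAWS OF A `B12Package Rz cB λ` AT NODE 00's OBJECTS: every by-reference
# package ties the curl of `λ.K` on `X` to the field strength of the PINNED `Rz.bgI` (two-sided, first order); the (1.16) window caps the letter at every recipe, a flat recipe
# (`RzOfRecord`) caps it at SECOND order; under the orbit-tie a non-flat pin FORCES the letter's curl, so small-curl letters (not only `𝐊 = 0`) are junk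

T. Bałaban, *Renormalization group approach to lattice gauge field theories. I*, Commun. Math. Phys. **109** (1987) 249–301 [Balaban1987RG1] (= [I]), §3 pp. 275–280.
TRACK A (YM-PLAN §2b), WIDTH SEAT `pub-ymgap-dag-n09-w5` (HUMAN RULING D-0154 ∕ director-ym R399 (3a)), generation g3; fourth LOCATED RIDER to FLAG №7 of record (director-ym
№209 «conjunct-1 JUNK-INHABITED at the unit recipe»; chair tags #4477∕#4618 «repair = proviso text»), PART B; PART A = `…N09B12LetterCurlIsPinnedFieldStrength` (the
identification `‖∂(B^{w⁻¹})(p) − 1 − iξ∂𝐊(p)‖ ≤ δ₀′` for p07's `JInputs` at `τ = 1`, any model); earlier riders p607123 ∕ p608883 ∕ p611726 ∕ p612606 ∕ p615304 (this seat, g0∕g2).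
Key of record it serves: K1⁷ `StabilityBAtRecordR13SepCoPH` = stmt-QuantumFields-20542 (`--supports`, helper; count-neutral).

WHAT IS PROVED (kernel bookkeeping at NODE 00's objects — `λ : ResidB12Run`, `pkg : B12Package Rz cB λ`, admissible `Φ ∈ U′ᶜ_{k+1}(□₀, (1+2β)α₀, (1+2β)α₁, α₀)`, `𝐀 ∈ (3.31)`,
`τ = 1`, `|B′| < α₃`, `ξ = L⁻ʲ`, `ξ′ = L^{−(k+1)}`, `B :=` the datum's pinned background `(λ.frameBox Rz).bg.Un (k+1) Φ₀.U = Rz.bgI` at `□̃⁵`, `∂𝐊(p)` = the four-term plaquette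
combination of `λ.K Φ 𝐀 1`, `c_w` ∕ `δ₀′(λ)` as in PART A; theorems only, def-free, sorry-free, standard axioms; riders 1–4A imported, nothing restated):
* ★ `norm_plaq_bg_repr_sub_one_le_curlK` — `‖∂B(p) − 1‖ ≤ e^{c_w}(ξ‖∂𝐊(p)‖ + δ₀′)` on `X` (PART 1 ★★ = its `λ.K = 0` case); ★ `xi_mul_norm_curlK_le_of_package` — the converse
  `ξ‖∂𝐊(p)‖ ≤ e^{c_w}‖∂B(p) − 1‖ + δ₀′`.
* ★★ `xi_mul_norm_curlK_lt_window_of_package` — THE WINDOW CAPS THE LETTER: `ξ‖∂𝐊(p)‖ < e^{c_w}(1+2β)α₀ξ′² + δ₀′` on `X` (fundamental case `X ⊆ (□₀)^{∼−2}` = `pkg.hXp'`), a law on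
  the letter map that EVERY `B12Package Rz cB λ` certifies at EVERY recipe `Rz`, tie or no tie.
* ★★ `xi_mul_norm_curlK_le_of_flat` ∕ `…_RzOfRecord` — at a TOTALLY-FLAT recipe (`∂U_m(M˙(V)) ≡ 1`; def-T's unit recipe = `RzOfRecord F N K` by `rfl`) EVERY package of EVERY
  layer has SECOND-ORDER CLOSED letters on `X`: `ξ‖∂𝐊(p)‖ ≤ δ₀′` — at the recipe of record not only do zero letters inhabit the package (p585162), ALL inhabitants are nearly
  curl-free.
* ★★★ `exists_lt_curlK_of_orbitTied_package_of_nonflat` — THE PIN FORCES THE LETTER: an ORBIT-TIED package, `0 ∈ (3.31)`, `0 < α₃`, and an admissible `Φ` witnessing NF(δ)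
  (every representative's pinned background has an `X`-plaquette off `1` by more than `δ`) ⇒ some `X`-plaquette with `δ < e^{c_w}(ξ‖∂(λ.K Φ 0 1)(p)‖ + δ₀′)`.
* ★★★ `not_exists_orbitTied_package_of_smallCurl`, `failingLemma_orbitTied_of_smallCurl` — PART 2 §3 GENERALISED from `λ.K = 0` to layers with `ξ‖∂(λ.K Φ 0 1)‖ ≤ κ` on `X`:
  under NF(e^{c_w}(κ + δ₀′)) no such layer carries an orbit-tied package (resp. `B12Provisos ∧` one); `smallCurl_of_zero_letters` (A6: the class at `κ = 0` contains every
  zero-letter layer — p585162's ∕ p607123's inhabitants — and every curl-free letter family).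

WHAT THIS MEANS FOR FLAG №7 (located; for director-ym ∕ dag-lead ∕ plan ∕ the def-T ∕ def-B12 desk ∕ referees).  (a) The junk class the repaired proviso text must exclude is
«letters whose curl on `X` does not carry the pin's field strength», of which `𝐊 = 0` is one member: under (T), NF(e^{c_w}(κ + δ₀′)) kills every layer with `ξ‖∂𝐊‖ ≤ κ` on `X`.
(b) Positively, at a tied package the pin's non-flatness `δ` REAPPEARS in the letter as `ξ‖∂𝐊(p)‖ > e^{−c_w}δ − δ₀′` somewhere on `X` — the quantitative content of «pin `bgI`
⇒ the letters are print's».  (c) The package disciplines the letter by itself: the (1.16) window caps `ξ‖∂𝐊‖` at first order at ANY recipe, and the unit recipe caps it at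
SECOND order — a closer of conjunct 1 stated at `RzOfRecord` can only ever exhibit nearly curl-free letters, whatever it names them.

HONEST FRAMING: LOCATED, count-neutral kernel bookkeeping on NODE 00's ∕ p07's ∕ pub-balaban's objects read BY NAME; HYPOTHESIS-FORM — the package, the tie (T) and the
non-flatness NF are DISPLAYED hypotheses asserted of NO pin of record; `δ₀′` is OUR explicit constant; NOT Lemma 4 for `U_j(□₀, ·)`; NO estimate of Bałaban's is proved or
denied; N09 NOT discharged; FLAG №7 neither closed nor widened (its located content made two-sided in the letters); K0⁷ ∕ K1⁷ NOT closed; counts unmoved (typed 28∕28 ·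
discharged 5∕27); no summit statement is proved by this seat; one finite four-torus programme at fixed `ε = L^{−K}` per run — conditional finite-𝕋⁴ bookkeeping; R4 closes
rung `BalabanLadder.UV` only; NOT ℝ⁴, NOT infinite volume, NOT OS, NOT a mass gap, NOT Clay.
-/

noncomputable section

namespace Summit.QuantumFields.YangMills.BalabanUVNodes.N09B12LetterCurlPackageLaws

open Literature.MathematicalPhysics.QuantumFieldTheory.Balaban1983to89
open Literature.MathematicalPhysics.QuantumFieldTheory.Balaban1983to89.Node00
open Literature.MathematicalPhysics.QuantumFieldTheory.Balaban1983to89.T4Continuum (T4Family)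
open Summit.QuantumFields.YangMills.BalabanUVNodes.N09B12LetterCurlIsPinnedFieldStrength
  (norm_plaq_bg_sub_one_le_curlK xi_mul_norm_curlK_le xi_mul_norm_curlK_lt_window xi_mul_norm_curlK_le_of_flat_bg)
open B12RegularSpaces111 (space Satisfies act plaq)
open B12RegularSpaces111Mono (plaq_one)
open B12RegularSpaces111SpecialUnitary (suModel)
open scoped Matrix.Norms.L2Operator

/-! ## §3. At NODE 00's objects: every `B12Package Rz cB λ` ties the curl of `λ.K` to the field strength of the PINNED `Rz.bgI` on `X` -/

section Package

variable {P : Params} {N M : ℕ} {Rz : Sect2.Residual P (MatA N)} {cB : ℝ}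

/-- **★ GENERAL-LETTER FLATNESS AT NODE 00's OBJECTS**: for a residual [B12] layer `λ` and ANY by-reference package `pkg : B12Package Rz cB λ`, at an admissible input `Φ`,
`𝐀 ∈ (3.31)`, `τ = 1`, `|B′| < α₃`, the datum's PINNED `(k+1)`-background (`(λ.frameBox Rz).bg.Un (k+1) = Rz.bgI` at `□̃⁵`) satisfies on `X`:
`‖∂B(p) − 1‖ ≤ e^{c_w}·(ξ‖∂(λ.K Φ 𝐀 1)(p)‖ + δ₀′(λ))` (`ξ = L⁻ʲ`).  PART 1 ★★ is the case `λ.K = 0`. [cite: Balaban1987RG1, (3.37)–(3.45) pp.277–279, Lemma 4 p.280 (bookkeeping)] -/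
theorem norm_plaq_bg_repr_sub_one_le_curlK (lam : ResidB12Run P N M) (pkg : B12Package Rz cB lam)
    {Φ : FieldPair P 0 (MatA N)ˣ (MatA N)}
    (hΦ : Φ ∈ space (suModel N) (lam.frameBox Rz) (lam.csBox cB) ((1 + 2 * lam.consts.β) * lam.consts.α₀) ((1 + 2 * lam.consts.β) * lam.consts.α₁) lam.α₀)
    {A : PBond P 0 → MatA N} (hA : A ∈ lam.A331) {B' : PBond P 0 → MatA N} (hB' : ‖B'‖ < lam.consts.α₃)
    (p : Plaq P 0) (hp : p ∈ (lam.frameX Rz).X.plaqs) :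
    ‖((plaq ((lam.frameBox Rz).bg.Un (lam.csBox cB).j (pkg.inputs Φ A 1 B' hΦ hA zero_le_one le_rfl hB').Φ₀.U) p : (MatA N)ˣ) : MatA N) - 1‖ ≤
      Real.exp (lam.consts.O₁ * lam.consts.M * lam.consts.α₁ + lam.consts.B₃ * lam.consts.O₁ * lam.consts.M * lam.consts.α₀ + lam.consts.B₃ * lam.consts.O₁ * lam.consts.M * lam.consts.α₀ + lam.consts.B₃ ^ 2 * lam.consts.O₁ * lam.consts.M * lam.consts.α₀) *
        ((lam.csX cB).ξ * ‖lam.K Φ A 1 ⟨p.src, p.μ⟩ + lam.K Φ A 1 ⟨p.src.shift p.μ, p.ν⟩ - lam.K Φ A 1 ⟨p.src.shift p.ν, p.μ⟩ - lam.K Φ A 1 ⟨p.src, p.ν⟩‖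
          + ((lam.csX cB).ξ ^ 2 * (2 * (lam.consts.B₃ * (lam.consts.B₃ * lam.consts.O₁ * lam.consts.M * lam.consts.α₀ * (lam.consts.L ^ (lam.idx.j - 1) * lam.idx.η)) ^ 2))
            + 1 / 2 * (4 * (lam.consts.B₃ ^ 2 * lam.consts.O₁ * lam.consts.M * lam.consts.α₀ * (lam.consts.L ^ (lam.idx.j - 1) * lam.idx.η))) ^ 2 * (lam.csX cB).ξ ^ 2 * Real.exp ((lam.csX cB).ξ * (4 * (lam.consts.B₃ ^ 2 * lam.consts.O₁ * lam.consts.M * lam.consts.α₀ * (lam.consts.L ^ (lam.idx.j - 1) * lam.idx.η)))))) :=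
  norm_plaq_bg_sub_one_le_curlK (pow_pos (inv_pos.mpr (Nat.cast_pos.mpr P.L_pos)) _) _ rfl p hp

/-- **★ THE CONVERSE AT NODE 00's OBJECTS**: same data, `ξ‖∂(λ.K Φ 𝐀 1)(p)‖ ≤ e^{c_w}·‖∂B(p) − 1‖ + δ₀′(λ)` on `X`.
[cite: Balaban1987RG1, (3.37)–(3.45) pp.277–279, Lemma 4 p.280 (bookkeeping)] -/
theorem xi_mul_norm_curlK_le_of_package (lam : ResidB12Run P N M) (pkg : B12Package Rz cB lam)
    {Φ : FieldPair P 0 (MatA N)ˣ (MatA N)}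
    (hΦ : Φ ∈ space (suModel N) (lam.frameBox Rz) (lam.csBox cB) ((1 + 2 * lam.consts.β) * lam.consts.α₀) ((1 + 2 * lam.consts.β) * lam.consts.α₁) lam.α₀)
    {A : PBond P 0 → MatA N} (hA : A ∈ lam.A331) {B' : PBond P 0 → MatA N} (hB' : ‖B'‖ < lam.consts.α₃)
    (p : Plaq P 0) (hp : p ∈ (lam.frameX Rz).X.plaqs) :
    (lam.csX cB).ξ * ‖lam.K Φ A 1 ⟨p.src, p.μ⟩ + lam.K Φ A 1 ⟨p.src.shift p.μ, p.ν⟩ - lam.K Φ A 1 ⟨p.src.shift p.ν, p.μ⟩ - lam.K Φ A 1 ⟨p.src, p.ν⟩‖ ≤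
      Real.exp (lam.consts.O₁ * lam.consts.M * lam.consts.α₁ + lam.consts.B₃ * lam.consts.O₁ * lam.consts.M * lam.consts.α₀ + lam.consts.B₃ * lam.consts.O₁ * lam.consts.M * lam.consts.α₀ + lam.consts.B₃ ^ 2 * lam.consts.O₁ * lam.consts.M * lam.consts.α₀) *
          ‖((plaq ((lam.frameBox Rz).bg.Un (lam.csBox cB).j (pkg.inputs Φ A 1 B' hΦ hA zero_le_one le_rfl hB').Φ₀.U) p : (MatA N)ˣ) : MatA N) - 1‖
        + ((lam.csX cB).ξ ^ 2 * (2 * (lam.consts.B₃ * (lam.consts.B₃ * lam.consts.O₁ * lam.consts.M * lam.consts.α₀ * (lam.consts.L ^ (lam.idx.j - 1) * lam.idx.η)) ^ 2))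
          + 1 / 2 * (4 * (lam.consts.B₃ ^ 2 * lam.consts.O₁ * lam.consts.M * lam.consts.α₀ * (lam.consts.L ^ (lam.idx.j - 1) * lam.idx.η))) ^ 2 * (lam.csX cB).ξ ^ 2 * Real.exp ((lam.csX cB).ξ * (4 * (lam.consts.B₃ ^ 2 * lam.consts.O₁ * lam.consts.M * lam.consts.α₀ * (lam.consts.L ^ (lam.idx.j - 1) * lam.idx.η))))) :=
  xi_mul_norm_curlK_le (pow_pos (inv_pos.mpr (Nat.cast_pos.mpr P.L_pos)) _) _ rfl p hp

/-- **★★ THE (1.16) WINDOW CAPS EVERY PACKAGE'S LETTER AT NODE 00's OBJECTS** (fundamental case `X ⊆ (□₀)^{∼−2}` = `pkg.hXp'`): same data,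
`ξ‖∂(λ.K Φ 𝐀 1)(p)‖ < e^{c_w}(1+2β)α₀ξ′² + δ₀′(λ)` on `X` (`ξ′ = L^{−(k+1)}`) — a law on the letter map `λ.K` that ANY `B12Package Rz cB λ` certifies at ANY recipe `Rz`, with or
without a tie. [cite: Balaban1987RG1, (1.15)–(1.16) p.262, (3.40) p.278, (3.45) p.279, Lemma 4 p.280 (bookkeeping)] -/
theorem xi_mul_norm_curlK_lt_window_of_package (lam : ResidB12Run P N M) (pkg : B12Package Rz cB lam)
    {Φ : FieldPair P 0 (MatA N)ˣ (MatA N)}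
    (hΦ : Φ ∈ space (suModel N) (lam.frameBox Rz) (lam.csBox cB) ((1 + 2 * lam.consts.β) * lam.consts.α₀) ((1 + 2 * lam.consts.β) * lam.consts.α₁) lam.α₀)
    {A : PBond P 0 → MatA N} (hA : A ∈ lam.A331) {B' : PBond P 0 → MatA N} (hB' : ‖B'‖ < lam.consts.α₃)
    (p : Plaq P 0) (hp : p ∈ (lam.frameX Rz).X.plaqs) :
    (lam.csX cB).ξ * ‖lam.K Φ A 1 ⟨p.src, p.μ⟩ + lam.K Φ A 1 ⟨p.src.shift p.μ, p.ν⟩ - lam.K Φ A 1 ⟨p.src.shift p.ν, p.μ⟩ - lam.K Φ A 1 ⟨p.src, p.ν⟩‖ <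
      Real.exp (lam.consts.O₁ * lam.consts.M * lam.consts.α₁ + lam.consts.B₃ * lam.consts.O₁ * lam.consts.M * lam.consts.α₀ + lam.consts.B₃ * lam.consts.O₁ * lam.consts.M * lam.consts.α₀ + lam.consts.B₃ ^ 2 * lam.consts.O₁ * lam.consts.M * lam.consts.α₀) *
          ((1 + 2 * lam.consts.β) * lam.consts.α₀ * (lam.csBox cB).ξ ^ 2)
        + ((lam.csX cB).ξ ^ 2 * (2 * (lam.consts.B₃ * (lam.consts.B₃ * lam.consts.O₁ * lam.consts.M * lam.consts.α₀ * (lam.consts.L ^ (lam.idx.j - 1) * lam.idx.η)) ^ 2))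
          + 1 / 2 * (4 * (lam.consts.B₃ ^ 2 * lam.consts.O₁ * lam.consts.M * lam.consts.α₀ * (lam.consts.L ^ (lam.idx.j - 1) * lam.idx.η))) ^ 2 * (lam.csX cB).ξ ^ 2 * Real.exp ((lam.csX cB).ξ * (4 * (lam.consts.B₃ ^ 2 * lam.consts.O₁ * lam.consts.M * lam.consts.α₀ * (lam.consts.L ^ (lam.idx.j - 1) * lam.idx.η))))) :=
  xi_mul_norm_curlK_lt_window (pow_pos (inv_pos.mpr (Nat.cast_pos.mpr P.L_pos)) _) (pkg.inputs Φ A 1 B' hΦ hA zero_le_one le_rfl hB') rfl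
    (Nat.le_add_left 1 lam.idx.k) p hp (pkg.hXp' hp)

/-- **★★ AT A TOTALLY-FLAT PIN EVERY PACKAGE'S LETTER IS SECOND-ORDER CLOSED ON `X`**: if the recipe's `(1.15)`-backgrounds are flat (`∂U_m(M˙(V)) ≡ 1` for every `V`), then for
every layer `λ`, EVERY `pkg : B12Package Rz cB λ` and the same data: `ξ‖∂(λ.K Φ 𝐀 1)(p)‖ ≤ δ₀′(λ)` on `X` — not only do zero letters inhabit the package at such a pin (p585162 ∕
p607123), ALL inhabitants have nearly curl-free letters there. [cite: Balaban1987RG1, (1.15) p.262, (3.39) p.278, (3.45) p.279 (bookkeeping)] -/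
theorem xi_mul_norm_curlK_le_of_flat (hUn : ∀ j Y m V p, plaq ((Rz.bgI j Y).Un m V) p = 1)
    (lam : ResidB12Run P N M) (pkg : B12Package Rz cB lam) {Φ : FieldPair P 0 (MatA N)ˣ (MatA N)}
    (hΦ : Φ ∈ space (suModel N) (lam.frameBox Rz) (lam.csBox cB) ((1 + 2 * lam.consts.β) * lam.consts.α₀) ((1 + 2 * lam.consts.β) * lam.consts.α₁) lam.α₀)
    {A : PBond P 0 → MatA N} (hA : A ∈ lam.A331) {B' : PBond P 0 → MatA N} (hB' : ‖B'‖ < lam.consts.α₃)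
    (p : Plaq P 0) (hp : p ∈ (lam.frameX Rz).X.plaqs) :
    (lam.csX cB).ξ * ‖lam.K Φ A 1 ⟨p.src, p.μ⟩ + lam.K Φ A 1 ⟨p.src.shift p.μ, p.ν⟩ - lam.K Φ A 1 ⟨p.src.shift p.ν, p.μ⟩ - lam.K Φ A 1 ⟨p.src, p.ν⟩‖ ≤
      (lam.csX cB).ξ ^ 2 * (2 * (lam.consts.B₃ * (lam.consts.B₃ * lam.consts.O₁ * lam.consts.M * lam.consts.α₀ * (lam.consts.L ^ (lam.idx.j - 1) * lam.idx.η)) ^ 2))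
        + 1 / 2 * (4 * (lam.consts.B₃ ^ 2 * lam.consts.O₁ * lam.consts.M * lam.consts.α₀ * (lam.consts.L ^ (lam.idx.j - 1) * lam.idx.η))) ^ 2 * (lam.csX cB).ξ ^ 2 * Real.exp ((lam.csX cB).ξ * (4 * (lam.consts.B₃ ^ 2 * lam.consts.O₁ * lam.consts.M * lam.consts.α₀ * (lam.consts.L ^ (lam.idx.j - 1) * lam.idx.η)))) :=
  xi_mul_norm_curlK_le_of_flat_bg (pow_pos (inv_pos.mpr (Nat.cast_pos.mpr P.L_pos)) _) (pkg.inputs Φ A 1 B' hΦ hA zero_le_one le_rfl hB') rfl p hp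
    (hUn _ _ _ _ p)

/-- **★★ … IN PARTICULAR AT `RzOfRecord F N K`** (= def-T's unit recipe `Sect2.Residual.unit`, by `rfl`; `∂1 = 1`): at the recipe of record EVERY package of EVERY layer has
SECOND-ORDER CLOSED letters on `X`, `ξ‖∂(λ.K Φ 𝐀 1)(p)‖ ≤ δ₀′(λ)` — print's letters carry the pin's field strength (§2), a flat pin leaves them nothing to carry. LOCATED; count-neutral.
[cite: Balaban1987RG1, (1.15) p.262, (3.45) p.279, Lemma 4 p.280 (bookkeeping)] -/
theorem xi_mul_norm_curlK_le_RzOfRecord (F : T4Family) (K : ℕ) {M : ℕ} {cB : ℝ} (lam : ResidB12Run (F.P K) N M)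
    (pkg : B12Package (RzOfRecord F N K) cB lam) {Φ : FieldPair (F.P K) 0 (MatA N)ˣ (MatA N)}
    (hΦ : Φ ∈ space (suModel N) (lam.frameBox (RzOfRecord F N K)) (lam.csBox cB) ((1 + 2 * lam.consts.β) * lam.consts.α₀)
      ((1 + 2 * lam.consts.β) * lam.consts.α₁) lam.α₀)
    {A : PBond (F.P K) 0 → MatA N} (hA : A ∈ lam.A331) {B' : PBond (F.P K) 0 → MatA N} (hB' : ‖B'‖ < lam.consts.α₃)
    (p : Plaq (F.P K) 0) (hp : p ∈ (lam.frameX (RzOfRecord F N K)).X.plaqs) :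
    (lam.csX cB).ξ * ‖lam.K Φ A 1 ⟨p.src, p.μ⟩ + lam.K Φ A 1 ⟨p.src.shift p.μ, p.ν⟩ - lam.K Φ A 1 ⟨p.src.shift p.ν, p.μ⟩ - lam.K Φ A 1 ⟨p.src, p.ν⟩‖ ≤
      (lam.csX cB).ξ ^ 2 * (2 * (lam.consts.B₃ * (lam.consts.B₃ * lam.consts.O₁ * lam.consts.M * lam.consts.α₀ * (lam.consts.L ^ (lam.idx.j - 1) * lam.idx.η)) ^ 2))
        + 1 / 2 * (4 * (lam.consts.B₃ ^ 2 * lam.consts.O₁ * lam.consts.M * lam.consts.α₀ * (lam.consts.L ^ (lam.idx.j - 1) * lam.idx.η))) ^ 2 * (lam.csX cB).ξ ^ 2 * Real.exp ((lam.csX cB).ξ * (4 * (lam.consts.B₃ ^ 2 * lam.consts.O₁ * lam.consts.M * lam.consts.α₀ * (lam.consts.L ^ (lam.idx.j - 1) * lam.idx.η)))) :=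
  xi_mul_norm_curlK_le_of_flat (fun _ _ _ _ p => plaq_one p) lam pkg hΦ hA hB' p hp

/-- **★★★ THE PIN FORCES THE LETTER** (positive form of №209's intent «pin `bgI` ⇒ the letters are print's»): let `pkg : B12Package Rz cB λ` be ORBIT-TIED (every datum `Φ₀` is an
(i)–(iv)-representative of the input's orbit), `0 ∈ (3.31)`, `0 < α₃`, and let the admissible input `Φ` witness NF(δ) (at EVERY representative `Φ₀` of its orbit the pinned
background has an `X`-plaquette off `1` by more than `δ`).  Then the letter `λ.K Φ 0 1` has an `X`-plaquette with `δ < e^{c_w}(ξ‖∂(λ.K Φ 0 1)(p)‖ + δ₀′(λ))` — the pin's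
non-flatness reappears, to first order, as curl of the letter. [cite: Balaban1987RG1, (3.39)–(3.40) p.278, (3.45) p.279, Lemma 4 p.280 (bookkeeping)] -/
theorem exists_lt_curlK_of_orbitTied_package_of_nonflat (lam : ResidB12Run P N M) (pkg : B12Package Rz cB lam)
    (hTie : ∀ Φ A τ B' hΦ hA hτ0 hτ1 hB', ∃ u : Site P 0 → (MatA N)ˣ,
        (∀ x, u x ∈ (suModel N).Gc) ∧ Φ = act u (pkg.inputs Φ A τ B' hΦ hA hτ0 hτ1 hB').Φ₀)
    (h0 : (0 : PBond P 0 → MatA N) ∈ lam.A331) (hα₃ : 0 < lam.consts.α₃) {δ : ℝ} {Φ : FieldPair P 0 (MatA N)ˣ (MatA N)}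
    (hΦ : Φ ∈ space (suModel N) (lam.frameBox Rz) (lam.csBox cB) ((1 + 2 * lam.consts.β) * lam.consts.α₀) ((1 + 2 * lam.consts.β) * lam.consts.α₁) lam.α₀)
    (hNF : ∀ (u : Site P 0 → (MatA N)ˣ) (Φ₀ : FieldPair P 0 (MatA N)ˣ (MatA N)), (∀ x, u x ∈ (suModel N).Gc) →
        Satisfies (suModel N) (lam.frameBox Rz) (lam.csBox cB) ((1 + 2 * lam.consts.β) * lam.consts.α₀) ((1 + 2 * lam.consts.β) * lam.consts.α₁) lam.α₀ Φ₀ →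
          Φ = act u Φ₀ → ∃ p ∈ (lam.frameX Rz).X.plaqs, δ < ‖((plaq ((lam.frameBox Rz).bg.Un (lam.csBox cB).j Φ₀.U) p : (MatA N)ˣ) : MatA N) - 1‖) :
    ∃ p ∈ (lam.frameX Rz).X.plaqs, δ <
      Real.exp (lam.consts.O₁ * lam.consts.M * lam.consts.α₁ + lam.consts.B₃ * lam.consts.O₁ * lam.consts.M * lam.consts.α₀ + lam.consts.B₃ * lam.consts.O₁ * lam.consts.M * lam.consts.α₀ + lam.consts.B₃ ^ 2 * lam.consts.O₁ * lam.consts.M * lam.consts.α₀) *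
        ((lam.csX cB).ξ * ‖lam.K Φ 0 1 ⟨p.src, p.μ⟩ + lam.K Φ 0 1 ⟨p.src.shift p.μ, p.ν⟩ - lam.K Φ 0 1 ⟨p.src.shift p.ν, p.μ⟩ - lam.K Φ 0 1 ⟨p.src, p.ν⟩‖
          + ((lam.csX cB).ξ ^ 2 * (2 * (lam.consts.B₃ * (lam.consts.B₃ * lam.consts.O₁ * lam.consts.M * lam.consts.α₀ * (lam.consts.L ^ (lam.idx.j - 1) * lam.idx.η)) ^ 2))
            + 1 / 2 * (4 * (lam.consts.B₃ ^ 2 * lam.consts.O₁ * lam.consts.M * lam.consts.α₀ * (lam.consts.L ^ (lam.idx.j - 1) * lam.idx.η))) ^ 2 * (lam.csX cB).ξ ^ 2 * Real.exp ((lam.csX cB).ξ * (4 * (lam.consts.B₃ ^ 2 * lam.consts.O₁ * lam.consts.M * lam.consts.α₀ * (lam.consts.L ^ (lam.idx.j - 1) * lam.idx.η)))))) := by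
  have hB' : ‖(0 : PBond P 0 → MatA N)‖ < lam.consts.α₃ := by rw [norm_zero]; exact hα₃
  obtain ⟨u, hu, hact⟩ := hTie Φ 0 1 0 hΦ h0 zero_le_one le_rfl hB'
  obtain ⟨p, hp, hlt⟩ := hNF u _ hu (pkg.inputs Φ 0 1 0 hΦ h0 zero_le_one le_rfl hB').hΦ₀ hact
  exact ⟨p, hp, hlt.trans_le (norm_plaq_bg_repr_sub_one_le_curlK lam pkg hΦ h0 hB' p hp)⟩

/-- **★★★ SMALL-CURL LETTERS ARE JUNK UNDER THE TIE AND A NON-FLAT PIN** (PART 2 §3 `not_exists_orbitTied_package_of_nonflat` GENERALISED from `λ.K = 0` to small curl): let the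
layer's letter at `(𝐀, τ) = (0, 1)` have `ξ‖∂(λ.K Φ 0 1)(p)‖ ≤ κ` on `X` for every admissible `Φ`, `0 ∈ (3.31)`, `0 < α₃`, and suppose NF(e^{c_w}(κ + δ₀′(λ))): SOME admissible input
all of whose representatives have an `X`-plaquette of the pinned background off `1` by MORE than `e^{c_w}(κ + δ₀′)`.  Then NO `B12Package Rz cB λ` is orbit-tied.  (`κ = 0`: zero
letters AND every curl-free letter family.) [cite: Balaban1987RG1, (3.39)–(3.40) p.278, (3.45) p.279, Lemma 4 p.280; (1.16) p.262 (bookkeeping)] -/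
theorem not_exists_orbitTied_package_of_smallCurl (lam : ResidB12Run P N M) {κ : ℝ}
    (hκ : ∀ Φ ∈ space (suModel N) (lam.frameBox Rz) (lam.csBox cB) ((1 + 2 * lam.consts.β) * lam.consts.α₀) ((1 + 2 * lam.consts.β) * lam.consts.α₁) lam.α₀,
      ∀ p ∈ (lam.frameX Rz).X.plaqs,
        (lam.csX cB).ξ * ‖lam.K Φ 0 1 ⟨p.src, p.μ⟩ + lam.K Φ 0 1 ⟨p.src.shift p.μ, p.ν⟩ - lam.K Φ 0 1 ⟨p.src.shift p.ν, p.μ⟩ - lam.K Φ 0 1 ⟨p.src, p.ν⟩‖ ≤ κ)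
    (h0 : (0 : PBond P 0 → MatA N) ∈ lam.A331) (hα₃ : 0 < lam.consts.α₃)
    (hNF : ∃ Φ ∈ space (suModel N) (lam.frameBox Rz) (lam.csBox cB) ((1 + 2 * lam.consts.β) * lam.consts.α₀) ((1 + 2 * lam.consts.β) * lam.consts.α₁) lam.α₀,
      ∀ (u : Site P 0 → (MatA N)ˣ) (Φ₀ : FieldPair P 0 (MatA N)ˣ (MatA N)), (∀ x, u x ∈ (suModel N).Gc) →
        Satisfies (suModel N) (lam.frameBox Rz) (lam.csBox cB) ((1 + 2 * lam.consts.β) * lam.consts.α₀) ((1 + 2 * lam.consts.β) * lam.consts.α₁) lam.α₀ Φ₀ →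
          Φ = act u Φ₀ → ∃ p ∈ (lam.frameX Rz).X.plaqs,
            Real.exp (lam.consts.O₁ * lam.consts.M * lam.consts.α₁ + lam.consts.B₃ * lam.consts.O₁ * lam.consts.M * lam.consts.α₀ + lam.consts.B₃ * lam.consts.O₁ * lam.consts.M * lam.consts.α₀ + lam.consts.B₃ ^ 2 * lam.consts.O₁ * lam.consts.M * lam.consts.α₀) *
              (κ + ((lam.csX cB).ξ ^ 2 * (2 * (lam.consts.B₃ * (lam.consts.B₃ * lam.consts.O₁ * lam.consts.M * lam.consts.α₀ * (lam.consts.L ^ (lam.idx.j - 1) * lam.idx.η)) ^ 2))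
                + 1 / 2 * (4 * (lam.consts.B₃ ^ 2 * lam.consts.O₁ * lam.consts.M * lam.consts.α₀ * (lam.consts.L ^ (lam.idx.j - 1) * lam.idx.η))) ^ 2 * (lam.csX cB).ξ ^ 2 * Real.exp ((lam.csX cB).ξ * (4 * (lam.consts.B₃ ^ 2 * lam.consts.O₁ * lam.consts.M * lam.consts.α₀ * (lam.consts.L ^ (lam.idx.j - 1) * lam.idx.η)))))) <
              ‖((plaq ((lam.frameBox Rz).bg.Un (lam.csBox cB).j Φ₀.U) p : (MatA N)ˣ) : MatA N) - 1‖) :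
    ¬ ∃ pkg : B12Package Rz cB lam, ∀ Φ A τ B' hΦ hA hτ0 hτ1 hB', ∃ u : Site P 0 → (MatA N)ˣ,
        (∀ x, u x ∈ (suModel N).Gc) ∧ Φ = act u (pkg.inputs Φ A τ B' hΦ hA hτ0 hτ1 hB').Φ₀ := by
  rintro ⟨pkg, hTie⟩
  obtain ⟨Φ, hΦ, hNFΦ⟩ := hNF
  obtain ⟨p, hp, hlt⟩ := exists_lt_curlK_of_orbitTied_package_of_nonflat lam pkg hTie h0 hα₃ hΦ hNFΦ
  refine (not_lt.mpr ?_) hlt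
  gcongr
  exact hκ Φ hΦ p hp

/-- **★★★ №209's «FAILING LEMMA» FOR SMALL-CURL LAYERS** (PART 2 §3 `failingLemma_orbitTied_of_nonflat`, generalised): a residual layer whose letter at `(0, 1)` has `ξ‖∂𝐊‖ ≤ κ` on `X`
does NOT carry `B12Provisos Rz cB λ` TOGETHER WITH an orbit-tied package once the pinned `bgI` meets NF(e^{c_w}(κ + δ₀′(λ))). LOCATED; hypothesis-form.
[cite: Balaban1987RG1, Lemma 4 (3.53) p.280, (3.39)–(3.40) p.278, (3.45) p.279 (bookkeeping)] -/
theorem failingLemma_orbitTied_of_smallCurl (lam : ResidB12Run P N M) {κ : ℝ}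
    (hκ : ∀ Φ ∈ space (suModel N) (lam.frameBox Rz) (lam.csBox cB) ((1 + 2 * lam.consts.β) * lam.consts.α₀) ((1 + 2 * lam.consts.β) * lam.consts.α₁) lam.α₀,
      ∀ p ∈ (lam.frameX Rz).X.plaqs,
        (lam.csX cB).ξ * ‖lam.K Φ 0 1 ⟨p.src, p.μ⟩ + lam.K Φ 0 1 ⟨p.src.shift p.μ, p.ν⟩ - lam.K Φ 0 1 ⟨p.src.shift p.ν, p.μ⟩ - lam.K Φ 0 1 ⟨p.src, p.ν⟩‖ ≤ κ)
    (hNF : ∃ Φ ∈ space (suModel N) (lam.frameBox Rz) (lam.csBox cB) ((1 + 2 * lam.consts.β) * lam.consts.α₀) ((1 + 2 * lam.consts.β) * lam.consts.α₁) lam.α₀,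
      ∀ (u : Site P 0 → (MatA N)ˣ) (Φ₀ : FieldPair P 0 (MatA N)ˣ (MatA N)), (∀ x, u x ∈ (suModel N).Gc) →
        Satisfies (suModel N) (lam.frameBox Rz) (lam.csBox cB) ((1 + 2 * lam.consts.β) * lam.consts.α₀) ((1 + 2 * lam.consts.β) * lam.consts.α₁) lam.α₀ Φ₀ →
          Φ = act u Φ₀ → ∃ p ∈ (lam.frameX Rz).X.plaqs,
            Real.exp (lam.consts.O₁ * lam.consts.M * lam.consts.α₁ + lam.consts.B₃ * lam.consts.O₁ * lam.consts.M * lam.consts.α₀ + lam.consts.B₃ * lam.consts.O₁ * lam.consts.M * lam.consts.α₀ + lam.consts.B₃ ^ 2 * lam.consts.O₁ * lam.consts.M * lam.consts.α₀) *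
              (κ + ((lam.csX cB).ξ ^ 2 * (2 * (lam.consts.B₃ * (lam.consts.B₃ * lam.consts.O₁ * lam.consts.M * lam.consts.α₀ * (lam.consts.L ^ (lam.idx.j - 1) * lam.idx.η)) ^ 2))
                + 1 / 2 * (4 * (lam.consts.B₃ ^ 2 * lam.consts.O₁ * lam.consts.M * lam.consts.α₀ * (lam.consts.L ^ (lam.idx.j - 1) * lam.idx.η))) ^ 2 * (lam.csX cB).ξ ^ 2 * Real.exp ((lam.csX cB).ξ * (4 * (lam.consts.B₃ ^ 2 * lam.consts.O₁ * lam.consts.M * lam.consts.α₀ * (lam.consts.L ^ (lam.idx.j - 1) * lam.idx.η)))))) <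
              ‖((plaq ((lam.frameBox Rz).bg.Un (lam.csBox cB).j Φ₀.U) p : (MatA N)ˣ) : MatA N) - 1‖) :
    ¬ (B12Provisos Rz cB lam ∧ ∃ pkg : B12Package Rz cB lam, ∀ Φ A τ B' hΦ hA hτ0 hτ1 hB', ∃ u : Site P 0 → (MatA N)ˣ,
        (∀ x, u x ∈ (suModel N).Gc) ∧ Φ = act u (pkg.inputs Φ A τ B' hΦ hA hτ0 hτ1 hB').Φ₀) := by
  rintro ⟨hP, hTie⟩
  exact not_exists_orbitTied_package_of_smallCurl lam hκ hP.zero_mem hP.restrictions.2.2.2.1 hNF hTie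

/-- **A6 — THE SMALL-CURL CLASS AT `κ = 0` CONTAINS EVERY ZERO-LETTER LAYER** (p585162's ∕ p607123's inhabitants of `B12Provisos`; PART 2 §3 is the `κ = 0` instance of
`not_exists_orbitTied_package_of_smallCurl`), and plainly every layer whose letter has zero curl on `X`. [cite: Balaban1987RG1, Lemma 4 p.280 (bookkeeping)] -/
theorem smallCurl_of_zero_letters (lam : ResidB12Run P N M) (hK : ∀ Φ A τ, lam.K Φ A τ = 0) :
    ∀ Φ ∈ space (suModel N) (lam.frameBox Rz) (lam.csBox cB) ((1 + 2 * lam.consts.β) * lam.consts.α₀) ((1 + 2 * lam.consts.β) * lam.consts.α₁) lam.α₀,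
      ∀ p ∈ (lam.frameX Rz).X.plaqs,
        (lam.csX cB).ξ * ‖lam.K Φ 0 1 ⟨p.src, p.μ⟩ + lam.K Φ 0 1 ⟨p.src.shift p.μ, p.ν⟩ - lam.K Φ 0 1 ⟨p.src.shift p.ν, p.μ⟩ - lam.K Φ 0 1 ⟨p.src, p.ν⟩‖ ≤ 0 := by
  intro Φ _ p _
  simp only [hK, Pi.zero_apply, add_zero, sub_self, norm_zero, mul_zero, le_refl]

end Package

end Summit.QuantumFields.YangMills.BalabanUVNodes.N09B12LetterCurlPackageLaws

end
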